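import Summits.CriticalPhenomena.SAWScalingLimit.Theses.SAWRenewalTightness
import Summits.CriticalPhenomena.SAWScalingLimit.Theses.SAWRestrictionRigidity
import Summits.CriticalPhenomena.SAWScalingLimit.Theses.SAWWeldingIdentification
import Summits.CriticalPhenomena.SAWScalingLimit.Theorems.SAWRenewalTightnessTightOfShellCrossing
import Summits.CriticalPhenomena.SAWScalingLimit.Theorems.SAWRenewalTightnessShellCrossingBoundOfPinchAway
import Summits.CriticalPhenomena.SAWScalingLimit.Theorems.SAWRenewalTightnessShellCrossingBoundSplit
import Summits.CriticalPhenomena.SAWScalingLimit.Theorems.SAWRenewalTightnessEventualTightOfBoundedVirginArc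
import Summits.CriticalPhenomena.SAWScalingLimit.Theorems.SAWRenewalTightnessEventualTightOfBoundaryBulk
import Literature.Probability.RandomPlanarGeometry.CurvePinch
import HarnessLib

/-!
# Line `boundary-repulsion` — crux `EventualTight` (stmt-CriticalPhenomena-1372): the E-FREE boundary half

Crux (FIXED; concluded BY NAME by `EventualTight_of` at
`Summit.CriticalPhenomena.SAWScalingLimit.Theses.SAWRenewalTightness.EventualTight`, the bet route; the
`SAWRestrictionRigidity` / `SAWWeldingIdentification` copies have byte-identical bodies and are concluded by the same
term below):

  `∀ D a b, SAW.IsEndpointApprox D a b → ∃ δ₀ > 0, IsTightMeasureSet ((δ ↦ (SAW.law D δ (a δ) (b δ)).map curve) '' Ioc 0 δ₀)`.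

## Idea (crux-strategist s4, 2026-08-17)

The live line `Sketch` (v13) and the route-level split of this crux (`EventualTight ⟸ ConfinementPositivity ∧
BulkShellTight`, glue `Theorems.EventualTight_of_subs`, p142144) both route the BOUNDARY shells of the
Aizenman–Burchard criterion through RESTRICTION POSITIVITY E (`ConfinementPositivity`, stmt-17587): enlarge the
domain so that the shell becomes interior, bound it there, and pay `1/c` to come back (restriction covariance).
E is a LOWER bound on a two-pinned critical partition-function ratio (`liminf Z_{D'}/Z_D > 0`); its only line
died today (`Cruxes/ConfinementPositivity/Lines/Sketch-dead.md`: Kesten irreducible-bridge primitives).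

Observation: the AB criterion as landed (`Theorems.shellCrossing_of_perShellDecay`, rate-free per-shell decay
suffices, p107371) needs NO lower bound.  A boundary shell is handled by an UPPER bound instead:

* **BR = `stub_boundaryRepulsion` (new atom, summit-implied).**  Away from its two marked points the critical SAW
  of `D_δ` does not come `s`-close to `∂D`, with probability `≥ 1 − ε` for `s = s(D, a, b, d, ε)` small and all
  small meshes: `P_δ[∃ t, γ̃(t) ∉ B(a, d) ∪ B(b, d) ∧ dist(γ̃(t), Dᶜ) ≤ s] ≤ ε`.  (SLE₈⸝₃ in `D` from `a` to `b`
  touches `∂D` only at `a, b`; Portmanteau on the closed collar event; so `SAWScalingLimit ⇒ BR`.)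
* **Glue (proved below, `perShellDecay_of_boundaryRepulsion_of_bulkShellTight`).**  Fix a shell `D(x; ρ, R)` and
  `ε`.  As in `Theorems.ShellCrossingBound_of_subs` pick a good middle circle `|y − x| = m` whose points are
  `2d`-far from `a, b` (`exists_good_mid`, `d = (R − ρ)/24`), get the collar width `s` from BR at `(d, ε/2)`, and
  put a net of `M` points on the circle with small shells `D(yᵢ; η, R')`, `η < R' ≤ s/4`.  A walk with `M·J + 1`
  traversals of the big shell makes `J + 1` traversals of some small shell (`exists_netPoint_hasTraversals`).
  EITHER `B̄(yᵢ, 2R') ⊆ D` — an interior shell OF `D` ITSELF, where `BulkShellTight` (stmt-17588, the bulk child,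
  ⟸ X2c₁ᵇ = stmt-18042 by `Theorems.bulkShellTight_of_virginArcTraversalTightBounded`) bounds the probability by
  `ε/(2M)` — OR some point of `Dᶜ` is within `2R'` of `yᵢ`, and then the passage point of any traversing strand
  (within `η` of `yᵢ`, hence `≥ 2d − η ≥ d` from `a, b`) is within `η + 2R' ≤ s` of `Dᶜ`: the walk is in the
  collar event, probability `≤ ε/2`.  Union bound: `ε/2 + M·ε/(2M) = ε`.  No enlargement, no restriction
  covariance, no division by `c`, no use of the Jordan property beyond what `BulkShellTight` already carries.

So `EventualTight ⟸ BR ∧ BulkShellTight` (this file) — to be compared with `⟸ E ∧ BulkShellTight` (the route's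
split).  BR and E are siblings (thin-collar ratio `→ 1` versus thick-complement ratio `≥ c`), neither implies the
other cheaply; BR is a ONE-SCALE `o_s(1)` wall-approach bound in the FIXED domain (no cascade over Whitney
generations, no rate), it is what the numerics of card `restriction-cascade` already measure (kit j023242 /
j023190: wall one-point density ∼ L^{-1.93}, point-approach exponent ≈ 1.8 > 1), and the glue is shorter.
What this line does NOT change: the bulk stub (`stub_bulkShellTight` = stmt-17588 ⟸ stmt-18042, the lead's
stuck goal) is the same research-grade atom as on the live line.

[cite: AizenmanBurchardDuke1999, §1.b and Lemma 3.1] [cite: LawlerSchrammWerner2004SAW, §3]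
-/

noncomputable section
open MeasureTheory Set Metric Filter Topology
open scoped unitInterval ENNReal Real
open Literature.Probability.RandomPlanarGeometry Literature.Probability.LatticeModels
open Summit.CriticalPhenomena.SAWScalingLimit.Theorems

namespace Summit.CriticalPhenomena.SAWScalingLimit.Cruxes.EventualTight.BoundaryRepulsion

/-! ### The two stubs -/

/-- **BR — boundary repulsion of the critical SAW away from the marked points** (NEW atom of this line;
summit-implied; not implied by the crux; a one-scale, rate-free UPPER bound in the fixed domain).
For every Dobrushin domain `D` with an endpoint approximation `(a_δ, b_δ)`, every socket radius `d > 0` and every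
`ε > 0` there are a collar width `s > 0` and a mesh threshold `δ₁ > 0` such that for `δ ∈ (0, δ₁]` the probability
that the polyline of the critical SAW of `D_δ` from `a_δ` to `b_δ` has a point outside `B(a, d) ∪ B(b, d)` (closed
form: at distance `≥ d` from both marked points) within distance `s` of the complement of `D` is at most `ε`.
[cite: LawlerSchrammWerner2004SAW, §3 (SLE₈⸝₃ does not touch the boundary)] -/
theorem stub_boundaryRepulsion :
    ∀ (D : DobrushinDomain) (a b : ℝ → Site 2), SAW.IsEndpointApprox D a b →
      ∀ d : ℝ, 0 < d → ∀ ε : ℝ, 0 < ε → ∃ (s δ₁ : ℝ), 0 < s ∧ 0 < δ₁ ∧ ∀ δ ∈ Set.Ioc (0 : ℝ) δ₁,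
        SAW.law D.carrier δ (a δ) (b δ)
          {γ | ∃ t : I, d ≤ dist ((⟨γ.walk.toCurve (meshPoint δ)⟩ : Curve ℂ) t) (D.pt 0) ∧
                d ≤ dist ((⟨γ.walk.toCurve (meshPoint δ)⟩ : Curve ℂ) t) (D.pt 1) ∧
                Metric.infDist ((⟨γ.walk.toCurve (meshPoint δ)⟩ : Curve ℂ) t) D.carrierᶜ ≤ s} ≤
          ENNReal.ofReal ε := by
  sorry

/-- **BulkShellTight — per-shell tightness of the traversal count on INTERIOR shells** (byte-identical to item
stmt-CriticalPhenomena-17588 `SAWRenewalTightness.BulkShellTight`, the bulk child of the route's split; implied by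
the bounded-exterior virgin-arc atom X2c₁ᵇ = stmt-CriticalPhenomena-18042 through
`Theorems.bulkShellTight_of_virginArcTraversalTightBounded`; NOT duplicated here — its chain is the live line's).
[cite: AizenmanBurchardDuke1999, Thm 1.1] -/
theorem stub_bulkShellTight :
    ∀ (D : DobrushinDomain) (a b : ℝ → Site 2), SAW.IsEndpointApprox D a b →
      ∀ (y : ℂ) (η R : ℝ), 0 < η → η < R → Metric.closedBall y (2 * R) ⊆ D.carrier →
        ∀ ε : ℝ, 0 < ε → ∃ (j : ℕ) (δ₁ : ℝ), 0 < δ₁ ∧ ∀ δ ∈ Set.Ioc (0 : ℝ) δ₁,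
          SAW.law D.carrier δ (a δ) (b δ)
            {γ | (⟨γ.walk.toCurve (meshPoint δ)⟩ : Curve ℂ).HasTraversals j y η R} ≤ ENNReal.ofReal ε := by
  sorry

/-- The second stub IS the route item `BulkShellTight` (stmt-CriticalPhenomena-17588), definitionally. -/
example : (∀ (D : DobrushinDomain) (a b : ℝ → Site 2), SAW.IsEndpointApprox D a b →
      ∀ (y : ℂ) (η R : ℝ), 0 < η → η < R → Metric.closedBall y (2 * R) ⊆ D.carrier →
        ∀ ε : ℝ, 0 < ε → ∃ (j : ℕ) (δ₁ : ℝ), 0 < δ₁ ∧ ∀ δ ∈ Set.Ioc (0 : ℝ) δ₁,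
          SAW.law D.carrier δ (a δ) (b δ)
            {γ | (⟨γ.walk.toCurve (meshPoint δ)⟩ : Curve ℂ).HasTraversals j y η R} ≤ ENNReal.ofReal ε) =
    Summit.CriticalPhenomena.SAWScalingLimit.Theses.SAWRenewalTightness.BulkShellTight := rfl

/-! ### The glue: per-shell decay in `D` from BR and bulk tightness in `D` itself -/

/-- **Per-shell decay from boundary repulsion and bulk tightness (the E-free boundary half).**  For every shell
`D(x; ρ, R)` and `ε > 0` there are a threshold `k` and a mesh threshold below which the critical SAW of `D_δ`
makes `k` separate traversals of the shell with probability `≤ ε`.  Proof: good middle circle, collar width from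
BR, circle net, net pigeonhole; at a net point whose `2R'`-ball is inside `D` use bulk tightness in `D`, at any
other net point a traversing strand visits the `s`-collar away from the sockets. [cite: AizenmanBurchardDuke1999, §1.b] -/
theorem perShellDecay_of_boundaryRepulsion_of_bulkShellTight
    (hBR : ∀ (D : DobrushinDomain) (a b : ℝ → Site 2), SAW.IsEndpointApprox D a b →
      ∀ d : ℝ, 0 < d → ∀ ε : ℝ, 0 < ε → ∃ (s δ₁ : ℝ), 0 < s ∧ 0 < δ₁ ∧ ∀ δ ∈ Set.Ioc (0 : ℝ) δ₁,
        SAW.law D.carrier δ (a δ) (b δ)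
          {γ | ∃ t : I, d ≤ dist ((⟨γ.walk.toCurve (meshPoint δ)⟩ : Curve ℂ) t) (D.pt 0) ∧
                d ≤ dist ((⟨γ.walk.toCurve (meshPoint δ)⟩ : Curve ℂ) t) (D.pt 1) ∧
                Metric.infDist ((⟨γ.walk.toCurve (meshPoint δ)⟩ : Curve ℂ) t) D.carrierᶜ ≤ s} ≤
          ENNReal.ofReal ε)
    (hB : ∀ (D : DobrushinDomain) (a b : ℝ → Site 2), SAW.IsEndpointApprox D a b →
      ∀ (y : ℂ) (η R : ℝ), 0 < η → η < R → Metric.closedBall y (2 * R) ⊆ D.carrier →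
        ∀ ε : ℝ, 0 < ε → ∃ (j : ℕ) (δ₁ : ℝ), 0 < δ₁ ∧ ∀ δ ∈ Set.Ioc (0 : ℝ) δ₁,
          SAW.law D.carrier δ (a δ) (b δ)
            {γ | (⟨γ.walk.toCurve (meshPoint δ)⟩ : Curve ℂ).HasTraversals j y η R} ≤ ENNReal.ofReal ε)
    (D : DobrushinDomain) (a b : ℝ → Site 2) (hab : SAW.IsEndpointApprox D a b) :
    ∀ (x : ℂ) (ρ R : ℝ), 0 < ρ → ρ < R → ∀ ε : ℝ, 0 < ε → ∃ (k : ℕ) (δ₁ : ℝ), 0 < δ₁ ∧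
      ∀ δ ∈ Set.Ioc (0 : ℝ) δ₁,
        SAW.law D.carrier δ (a δ) (b δ)
          {γ | (⟨γ.walk.toCurve (meshPoint δ)⟩ : Curve ℂ).HasTraversals k x ρ R} ≤ ENNReal.ofReal ε := by
  intro x ρ R hρ hρR ε hε
  classical
  /- (1) a good middle radius and its sub-shell -/
  obtain ⟨m, hm1, hm2, hfa, hfb⟩ := exists_good_mid hρR (dist (D.pt 0) x) (dist (D.pt 1) x)
  set w : ℝ := (R - ρ) / 3 with hw_def
  have hw : 0 < w := by rw [hw_def]; linarith
  have h6 : (R - ρ) / 6 = w / 2 := by rw [hw_def]; ring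
  have hρm : ρ + w / 2 ≤ m := by linarith
  have hmR : m + w / 2 ≤ R := by linarith
  have hmpos : 0 < m := by linarith
  set ρ₁ : ℝ := m - w / 2 with hρ₁_def
  set R₁ : ℝ := m + w / 2 with hR₁_def
  have hρρ₁ : ρ ≤ ρ₁ := by rw [hρ₁_def]; linarith
  have hR₁R : R₁ ≤ R := by rw [hR₁_def]; linarith
  have hρ₁m : ρ₁ < m := by rw [hρ₁_def]; linarith
  have hmR₁ : m < R₁ := by rw [hR₁_def]; linarith
  /- (2) socket radius `d = w/8 = (R - ρ)/24` and the collar width from boundary repulsion at `(d, ε/2)` -/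
  set d : ℝ := w / 8 with hd_def
  have hd : 0 < d := by positivity
  have h2d : 2 * d = (R - ρ) / 12 := by rw [hd_def, hw_def]; ring
  obtain ⟨s, δB, hs, hδB, hcollar⟩ := hBR D a b hab d hd (ε / 2) (by positivity)
  /- (3) radii of the small shells, resolution and size of the net -/
  set R' : ℝ := min (w / 4) (s / 4) with hR'_def
  have hR' : 0 < R' := lt_min (by positivity) (by positivity)
  have hR'w : R' ≤ w / 4 := min_le_left _ _
  have hR's : R' ≤ s / 4 := min_le_right _ _
  set η₀ : ℝ := min R' d / 2 with hη₀_def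
  have hmin : 0 < min R' d := lt_min hR' hd
  have hη₀ : 0 < η₀ := by rw [hη₀_def]; positivity
  have hη₀R' : η₀ < R' := by
    have := min_le_left R' d
    rw [hη₀_def]; linarith
  have hη₀d : η₀ < d := by
    have := min_le_right R' d
    rw [hη₀_def]; linarith
  set M : ℕ := ⌈2 * π * m / η₀⌉₊ + 1 with hM_def
  have hM1 : 1 ≤ M := by omega
  have hMpos : (0 : ℝ) < M := by exact_mod_cast (show 0 < M by omega)
  have hMgt : 2 * π * m / η₀ < M := by
    have h1 := Nat.le_ceil (2 * π * m / η₀)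
    have h2 : (M : ℝ) = (⌈2 * π * m / η₀⌉₊ : ℝ) + 1 := by rw [hM_def]; push_cast; ring
    rw [h2]
    linarith
  set η : ℝ := 2 * π * m / M with hη_def
  have hη : 0 < η := by rw [hη_def]; positivity
  have hηη₀ : η < η₀ := by
    rw [hη_def, div_lt_iff₀ hMpos]
    have h1 := (div_lt_iff₀ hη₀).1 hMgt
    linarith [mul_comm (M : ℝ) η₀]
  have hηR' : η < R' := hηη₀.trans hη₀R'
  have hηd : η ≤ d := (hηη₀.trans hη₀d).le
  have hηs : η + 2 * R' ≤ s := by linarith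
  -- the net points
  let N : ℕ → ℂ := fun i => x + (m : ℂ) * Complex.exp (((-π + 2 * π * i / M : ℝ) : ℂ) * Complex.I)
  have hNdist : ∀ i, dist (N i) x = m := fun i => by
    show dist (x + (m : ℂ) * Complex.exp (((-π + 2 * π * i / M : ℝ) : ℂ) * Complex.I)) x = m
    rw [dist_eq_norm, add_sub_cancel_left, norm_mul, Complex.norm_real, Real.norm_eq_abs,
      abs_of_nonneg hmpos.le, Complex.norm_exp_ofReal_mul_I, mul_one]
  -- the net points are `2d = (R - ρ)/12` away from the marked points
  have hfar : ∀ (p : ℂ) (i : ℕ), (R - ρ) / 12 ≤ |dist p x - m| → 2 * d ≤ dist (N i) p := by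
    intro p i hp
    have h1 := abs_dist_sub_le p (N i) x
    rw [hNdist i] at h1
    rw [dist_comm, h2d]
    linarith
  /- (4) the bound at each net point whose `2R'`-ball is inside `D`: bulk tightness in `D` itself -/
  set ε' : ℝ := ε / (2 * M) with hε'_def
  have hε' : 0 < ε' := by rw [hε'_def]; positivity
  have key : ∀ i : Fin M, ∃ (j : ℕ) (δi : ℝ), 0 < δi ∧ ∀ δ ∈ Set.Ioc (0 : ℝ) δi,
      SAW.law D.carrier δ (a δ) (b δ)
        {γ | closedBall (N i) (2 * R') ⊆ D.carrier ∧
          (⟨γ.walk.toCurve (meshPoint δ)⟩ : Curve ℂ).HasTraversals j (N i) η R'} ≤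
        ENNReal.ofReal ε' := by
    intro i
    by_cases hball : closedBall (N i) (2 * R') ⊆ D.carrier
    · obtain ⟨j, δF, hδF, hbig⟩ := hB D a b hab (N i) η R' hη hηR' hball ε' hε'
      exact ⟨j, δF, hδF, fun δ hδ => le_trans (measure_mono fun γ hγ => hγ.2) (hbig δ hδ)⟩
    · refine ⟨0, 1, one_pos, fun δ hδ => ?_⟩
      have hempty : {γ : SAW.DomainSAW D.carrier δ (a δ) (b δ) |
          closedBall (N i) (2 * R') ⊆ D.carrier ∧
            (⟨γ.walk.toCurve (meshPoint δ)⟩ : Curve ℂ).HasTraversals 0 (N i) η R'} = ∅ :=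
        Set.eq_empty_iff_forall_notMem.2 fun γ hγ => hball hγ.1
      rw [hempty, measure_empty]
      exact bot_le
  choose j δi hδi hbound using key
  /- (5) thresholds, net pigeonhole, the collar alternative and the union bound -/
  haveI : NeZero M := ⟨by omega⟩
  set J : ℕ := Finset.univ.sup j with hJ_def
  have hjJ : ∀ i, j i ≤ J := fun i => Finset.le_sup (f := j) (Finset.mem_univ i)
  set δ₁ : ℝ := min δB (Finset.univ.inf' Finset.univ_nonempty δi) with hδ₁_def
  have hδ₁ : 0 < δ₁ := lt_min hδB ((Finset.lt_inf'_iff _).2 fun i _ => hδi i)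
  have hδ₁B : δ₁ ≤ δB := min_le_left _ _
  have hδ₁le : ∀ i, δ₁ ≤ δi i := fun i =>
    (min_le_right _ _).trans (Finset.inf'_le _ (Finset.mem_univ i))
  refine ⟨M * J + 1, δ₁, hδ₁, fun δ hδ => ?_⟩
  -- the event inclusion: collar visit, or many traversals of a small interior shell
  have hsubev : {γ : SAW.DomainSAW D.carrier δ (a δ) (b δ) |
        (⟨γ.walk.toCurve (meshPoint δ)⟩ : Curve ℂ).HasTraversals (M * J + 1) x ρ R} ⊆
      {γ | ∃ t : I, d ≤ dist ((⟨γ.walk.toCurve (meshPoint δ)⟩ : Curve ℂ) t) (D.pt 0) ∧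
          d ≤ dist ((⟨γ.walk.toCurve (meshPoint δ)⟩ : Curve ℂ) t) (D.pt 1) ∧
          Metric.infDist ((⟨γ.walk.toCurve (meshPoint δ)⟩ : Curve ℂ) t) D.carrierᶜ ≤ s} ∪
      ⋃ i : Fin M, {γ | closedBall (N i) (2 * R') ⊆ D.carrier ∧
          (⟨γ.walk.toCurve (meshPoint δ)⟩ : Curve ℂ).HasTraversals (j i) (N i) η R'} := by
    intro γ hγ
    have h1 : (⟨γ.walk.toCurve (meshPoint δ)⟩ : Curve ℂ).HasTraversals (M * J + 1) x ρ₁ R₁ :=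
      Curve.HasTraversals.mono' hγ hρρ₁ hR₁R
    have hin : R' ≤ m - ρ₁ := by rw [hρ₁_def]; linarith
    have hout : R' ≤ R₁ - m := by rw [hR₁_def]; linarith
    obtain ⟨i, hiM, htrav⟩ := exists_netPoint_hasTraversals hρ₁m hmR₁ hmpos hin hout hM1 h1
    by_cases hgood : closedBall (N i) (2 * R') ⊆ D.carrier
    · refine Or.inr (Set.mem_iUnion.2 ⟨⟨i, hiM⟩, hgood, ?_⟩)
      have hle : j ⟨i, hiM⟩ ≤ J + 1 := (hjJ ⟨i, hiM⟩).trans (Nat.le_succ J)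
      exact Curve.HasTraversals.of_le htrav hle
    · left
      -- a passage point of a traversing strand: within `η` of the net point
      obtain ⟨sP, tP, hst, -⟩ := htrav
      obtain ⟨t, ht⟩ : ∃ t : I,
          dist ((⟨γ.walk.toCurve (meshPoint δ)⟩ : Curve ℂ) t) (N i) ≤ η := by
        rcases (hst 0).2 with ⟨h, -⟩ | ⟨-, h⟩
        · exact ⟨sP 0, h⟩
        · exact ⟨tP 0, h⟩
      -- a point of the complement within `2R'` of the net point
      obtain ⟨q, hq, hqD⟩ := Set.not_subset.1 hgood
      rw [mem_closedBall] at hq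
      refine ⟨t, ?_, ?_, ?_⟩
      · have h1 := hfar (D.pt 0) i hfa
        have h2 := dist_triangle (N i) ((⟨γ.walk.toCurve (meshPoint δ)⟩ : Curve ℂ) t) (D.pt 0)
        rw [dist_comm] at ht
        linarith
      · have h1 := hfar (D.pt 1) i hfb
        have h2 := dist_triangle (N i) ((⟨γ.walk.toCurve (meshPoint δ)⟩ : Curve ℂ) t) (D.pt 1)
        rw [dist_comm] at ht
        linarith
      · calc Metric.infDist ((⟨γ.walk.toCurve (meshPoint δ)⟩ : Curve ℂ) t) D.carrierᶜ
            ≤ dist ((⟨γ.walk.toCurve (meshPoint δ)⟩ : Curve ℂ) t) q := Metric.infDist_le_dist_of_mem hqD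
          _ ≤ dist ((⟨γ.walk.toCurve (meshPoint δ)⟩ : Curve ℂ) t) (N i) + dist q (N i) := by
              rw [dist_comm q (N i)]; exact dist_triangle _ _ _
          _ ≤ η + 2 * R' := add_le_add ht hq
          _ ≤ s := hηs
  have hδB' : δ ∈ Set.Ioc (0 : ℝ) δB := ⟨hδ.1, hδ.2.trans hδ₁B⟩
  calc SAW.law D.carrier δ (a δ) (b δ) {γ : SAW.DomainSAW D.carrier δ (a δ) (b δ) |
          (⟨γ.walk.toCurve (meshPoint δ)⟩ : Curve ℂ).HasTraversals (M * J + 1) x ρ R}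
      ≤ SAW.law D.carrier δ (a δ) (b δ)
          ({γ | ∃ t : I, d ≤ dist ((⟨γ.walk.toCurve (meshPoint δ)⟩ : Curve ℂ) t) (D.pt 0) ∧
              d ≤ dist ((⟨γ.walk.toCurve (meshPoint δ)⟩ : Curve ℂ) t) (D.pt 1) ∧
              Metric.infDist ((⟨γ.walk.toCurve (meshPoint δ)⟩ : Curve ℂ) t) D.carrierᶜ ≤ s} ∪
          ⋃ i : Fin M, {γ | closedBall (N i) (2 * R') ⊆ D.carrier ∧
              (⟨γ.walk.toCurve (meshPoint δ)⟩ : Curve ℂ).HasTraversals (j i) (N i) η R'}) :=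
        measure_mono hsubev
    _ ≤ SAW.law D.carrier δ (a δ) (b δ)
          {γ | ∃ t : I, d ≤ dist ((⟨γ.walk.toCurve (meshPoint δ)⟩ : Curve ℂ) t) (D.pt 0) ∧
              d ≤ dist ((⟨γ.walk.toCurve (meshPoint δ)⟩ : Curve ℂ) t) (D.pt 1) ∧
              Metric.infDist ((⟨γ.walk.toCurve (meshPoint δ)⟩ : Curve ℂ) t) D.carrierᶜ ≤ s} +
        SAW.law D.carrier δ (a δ) (b δ)
          (⋃ i : Fin M, {γ | closedBall (N i) (2 * R') ⊆ D.carrier ∧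
              (⟨γ.walk.toCurve (meshPoint δ)⟩ : Curve ℂ).HasTraversals (j i) (N i) η R'}) :=
        measure_union_le _ _
    _ ≤ ENNReal.ofReal (ε / 2) + ∑ i : Fin M, SAW.law D.carrier δ (a δ) (b δ)
          {γ | closedBall (N i) (2 * R') ⊆ D.carrier ∧
              (⟨γ.walk.toCurve (meshPoint δ)⟩ : Curve ℂ).HasTraversals (j i) (N i) η R'} :=
        add_le_add (hcollar δ hδB') (measure_iUnion_fintype_le _ _)
    _ ≤ ENNReal.ofReal (ε / 2) + ∑ _i : Fin M, ENNReal.ofReal ε' :=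
        add_le_add le_rfl (Finset.sum_le_sum fun i _ => hbound i δ ⟨hδ.1, hδ.2.trans (hδ₁le i)⟩)
    _ = ENNReal.ofReal (ε / 2) + ENNReal.ofReal (M * ε') := by
        rw [Finset.sum_const, Finset.card_univ, Fintype.card_fin, nsmul_eq_mul,
          ENNReal.ofReal_mul (Nat.cast_nonneg M), ENNReal.ofReal_natCast]
    _ = ENNReal.ofReal ε := by
        rw [← ENNReal.ofReal_add (by positivity) (by positivity)]
        congr 1
        rw [hε'_def]
        field_simp
        ring

/-- **`ShellCrossingBound` from BR and bulk tightness** (the AB dress: `shellCrossing_of_perShellDecay`, p107371).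
[cite: AizenmanBurchardDuke1999, §1.b and Lemma 3.1] -/
theorem shellCrossingBound_of_boundaryRepulsion_of_bulkShellTight
    (hBR : ∀ (D : DobrushinDomain) (a b : ℝ → Site 2), SAW.IsEndpointApprox D a b →
      ∀ d : ℝ, 0 < d → ∀ ε : ℝ, 0 < ε → ∃ (s δ₁ : ℝ), 0 < s ∧ 0 < δ₁ ∧ ∀ δ ∈ Set.Ioc (0 : ℝ) δ₁,
        SAW.law D.carrier δ (a δ) (b δ)
          {γ | ∃ t : I, d ≤ dist ((⟨γ.walk.toCurve (meshPoint δ)⟩ : Curve ℂ) t) (D.pt 0) ∧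
                d ≤ dist ((⟨γ.walk.toCurve (meshPoint δ)⟩ : Curve ℂ) t) (D.pt 1) ∧
                Metric.infDist ((⟨γ.walk.toCurve (meshPoint δ)⟩ : Curve ℂ) t) D.carrierᶜ ≤ s} ≤
          ENNReal.ofReal ε)
    (hB : ∀ (D : DobrushinDomain) (a b : ℝ → Site 2), SAW.IsEndpointApprox D a b →
      ∀ (y : ℂ) (η R : ℝ), 0 < η → η < R → Metric.closedBall y (2 * R) ⊆ D.carrier →
        ∀ ε : ℝ, 0 < ε → ∃ (j : ℕ) (δ₁ : ℝ), 0 < δ₁ ∧ ∀ δ ∈ Set.Ioc (0 : ℝ) δ₁,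
          SAW.law D.carrier δ (a δ) (b δ)
            {γ | (⟨γ.walk.toCurve (meshPoint δ)⟩ : Curve ℂ).HasTraversals j y η R} ≤ ENNReal.ofReal ε) :
    Summit.CriticalPhenomena.SAWScalingLimit.Theses.SAWRenewalTightness.ShellCrossingBound :=
  fun D a b hab => shellCrossing_of_perShellDecay D a b
    (perShellDecay_of_boundaryRepulsion_of_bulkShellTight hBR hB D a b hab)

/-! ### The composition: the crux BY NAME from the two stubs -/

/-- **`EventualTight` from the line `boundary-repulsion`** (kernel-checked, no `sorry` of its own):
BR and `BulkShellTight` give `ShellCrossingBound` (above) and the landed Aizenman–Burchard criterion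
`Theorems.TightOfShellCrossing_proof` (item stmt-4732) closes the crux.  Hypotheses = the two registered stubs'
statements. [cite: AizenmanBurchardDuke1999, Thms 1.1-1.2 and Lemma 3.1] -/
theorem EventualTight_of
    (hBR : ∀ (D : DobrushinDomain) (a b : ℝ → Site 2), SAW.IsEndpointApprox D a b →
      ∀ d : ℝ, 0 < d → ∀ ε : ℝ, 0 < ε → ∃ (s δ₁ : ℝ), 0 < s ∧ 0 < δ₁ ∧ ∀ δ ∈ Set.Ioc (0 : ℝ) δ₁,
        SAW.law D.carrier δ (a δ) (b δ)
          {γ | ∃ t : I, d ≤ dist ((⟨γ.walk.toCurve (meshPoint δ)⟩ : Curve ℂ) t) (D.pt 0) ∧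
                d ≤ dist ((⟨γ.walk.toCurve (meshPoint δ)⟩ : Curve ℂ) t) (D.pt 1) ∧
                Metric.infDist ((⟨γ.walk.toCurve (meshPoint δ)⟩ : Curve ℂ) t) D.carrierᶜ ≤ s} ≤
          ENNReal.ofReal ε)
    (hB : ∀ (D : DobrushinDomain) (a b : ℝ → Site 2), SAW.IsEndpointApprox D a b →
      ∀ (y : ℂ) (η R : ℝ), 0 < η → η < R → Metric.closedBall y (2 * R) ⊆ D.carrier →
        ∀ ε : ℝ, 0 < ε → ∃ (j : ℕ) (δ₁ : ℝ), 0 < δ₁ ∧ ∀ δ ∈ Set.Ioc (0 : ℝ) δ₁,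
          SAW.law D.carrier δ (a δ) (b δ)
            {γ | (⟨γ.walk.toCurve (meshPoint δ)⟩ : Curve ℂ).HasTraversals j y η R} ≤ ENNReal.ofReal ε) :
    Summit.CriticalPhenomena.SAWScalingLimit.Theses.SAWRenewalTightness.EventualTight :=
  TightOfShellCrossing_proof (shellCrossingBound_of_boundaryRepulsion_of_bulkShellTight hBR hB)

/-- **The crux proof modulo the two stubs** (wiring check; becomes the crux proof when the two `sorry`s are
discharged) — at the bet route's decl `SAWRenewalTightness.EventualTight`. -/
theorem EventualTight_proof :
    Summit.CriticalPhenomena.SAWScalingLimit.Theses.SAWRenewalTightness.EventualTight :=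
  EventualTight_of stub_boundaryRepulsion stub_bulkShellTight

/-- The same wiring against the `SAWRestrictionRigidity` copy of the crux decl (byte-identical body). -/
theorem EventualTight_proof_restriction :
    Summit.CriticalPhenomena.SAWScalingLimit.Theses.SAWRestrictionRigidity.EventualTight :=
  EventualTight_of stub_boundaryRepulsion stub_bulkShellTight

/-- The same wiring against the `SAWWeldingIdentification` copy of the crux decl (byte-identical body). -/
theorem EventualTight_proof_welding :
    Summit.CriticalPhenomena.SAWScalingLimit.Theses.SAWWeldingIdentification.EventualTight :=
  EventualTight_of stub_boundaryRepulsion stub_bulkShellTight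

/-- **Items wiring.**  With the bulk stub discharged from the bounded-exterior virgin-arc atom X2c₁ᵇ
(item stmt-CriticalPhenomena-18042, verbatim hypothesis of `Theorems.bulkShellTight_of_virginArcTraversalTightBounded`):
`EventualTight ⟸ BR ∧ X2c₁ᵇ` — the E-free counterpart of the route glue
`Theorems.eventualTight_of_virginArcTraversalTightBounded_of_confinementPositivity` (p151500). -/
theorem EventualTight_of_boundaryRepulsion_of_virginArcTraversalTightBounded
    (hBR : ∀ (D : DobrushinDomain) (a b : ℝ → Site 2), SAW.IsEndpointApprox D a b →
      ∀ d : ℝ, 0 < d → ∀ ε : ℝ, 0 < ε → ∃ (s δ₁ : ℝ), 0 < s ∧ 0 < δ₁ ∧ ∀ δ ∈ Set.Ioc (0 : ℝ) δ₁,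
        SAW.law D.carrier δ (a δ) (b δ)
          {γ | ∃ t : I, d ≤ dist ((⟨γ.walk.toCurve (meshPoint δ)⟩ : Curve ℂ) t) (D.pt 0) ∧
                d ≤ dist ((⟨γ.walk.toCurve (meshPoint δ)⟩ : Curve ℂ) t) (D.pt 1) ∧
                Metric.infDist ((⟨γ.walk.toCurve (meshPoint δ)⟩ : Curve ℂ) t) D.carrierᶜ ≤ s} ≤
          ENNReal.ofReal ε)
    (hX : ∀ C θ : ℝ, 0 < θ →
      ∃ (k : ℕ) (N₀ : ℝ), 0 < N₀ ∧
        ∀ (H : SimpleGraph (Site 2)) (Λ : Set (Site 2)) (z₀ : ℂ) (N : ℝ) (u c u' c' : Site 2),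
          Λ.Finite → (∀ v ∈ Λ, dist (Site.toComplex v) z₀ ≤ C * N) → N₀ ≤ N →
          (H ≤ zdGraph 2 ∧ (∀ v : Site 2, dist (Site.toComplex v) z₀ ≤ N → v ∈ Λ) ∧
            ∀ v v' : Site 2, dist (Site.toComplex v) z₀ ≤ N + 1 →
              dist (Site.toComplex v') z₀ ≤ N + 1 → (zdGraph 2).Adj v v' → H.Adj v v') →
          (H.Adj u c ∧ u ∉ Λ ∧ c ∈ Λ ∧ dist (Site.toComplex c) z₀ ≤ N ∧
            N < dist (Site.toComplex u) z₀) →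
          (H.Adj u' c' ∧ u' ∉ Λ ∧ c' ∈ Λ ∧ dist (Site.toComplex c') z₀ ≤ N ∧
            N < dist (Site.toComplex u') z₀) →
          ∑' p : {p : {p : H.Walk c c' // p.IsPath ∧ ∀ v ∈ p.support, v ∈ Λ} //
              ∃ ι κ : Fin k → Fin (p.1.support.map Site.toComplex).length, (∀ m, ι m ≤ κ m) ∧
                (∀ m, (dist ((p.1.support.map Site.toComplex).get (ι m)) z₀ ≤ 2 * N / 5 ∧
                    3 * N / 5 ≤ dist ((p.1.support.map Site.toComplex).get (κ m)) z₀) ∨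
                  (3 * N / 5 ≤ dist ((p.1.support.map Site.toComplex).get (ι m)) z₀ ∧
                    dist ((p.1.support.map Site.toComplex).get (κ m)) z₀ ≤ 2 * N / 5)) ∧
                ∀ ⦃m m'⦄, m < m' → κ m ≤ ι m'},
              ENNReal.ofReal (SAW.criticalFugacity ^ p.1.1.length) ≤
            ENNReal.ofReal θ *
              ∑' p : {p : H.Walk c c' // p.IsPath ∧ ∀ v ∈ p.support, v ∈ Λ},
                ENNReal.ofReal (SAW.criticalFugacity ^ p.1.length)) :
    Summit.CriticalPhenomena.SAWScalingLimit.Theses.SAWRenewalTightness.EventualTight :=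
  EventualTight_of hBR (bulkShellTight_of_virginArcTraversalTightBounded hX)

/-! ### Cross-line corollary: BR is a sufficient one-scale atom for the boundary residual B of line `boundary_bulk` -/

/-- **`BoundaryShellTight ⟸ BR ∧ BulkShellTight`.**  The exact E-free residual of the sibling line `boundary_bulk`
(`Theorems.eventualTight_iff_bulkShellTight_and_boundaryShellTight`, p172517: `EventualTight ↔ BulkShellTight ∧ B` with
`B = Theorems.TPToTraversalBound.Radial.BoundaryShellTight`, frontier-centred count tightness, also the residual of crux
stmt-10687) follows from boundary repulsion and bulk tightness: per-shell decay holds at EVERY shell. So the two alternative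
lines compose — `EventualTight ⟸ BulkShellTight ∧ BR` with BR a ONE-SCALE collar event. [folklore] -/
theorem boundaryShellTight_of_boundaryRepulsion_of_bulkShellTight
    (hBR : ∀ (D : DobrushinDomain) (a b : ℝ → Site 2), SAW.IsEndpointApprox D a b →
      ∀ d : ℝ, 0 < d → ∀ ε : ℝ, 0 < ε → ∃ (s δ₁ : ℝ), 0 < s ∧ 0 < δ₁ ∧ ∀ δ ∈ Set.Ioc (0 : ℝ) δ₁,
        SAW.law D.carrier δ (a δ) (b δ)
          {γ | ∃ t : I, d ≤ dist ((⟨γ.walk.toCurve (meshPoint δ)⟩ : Curve ℂ) t) (D.pt 0) ∧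
                d ≤ dist ((⟨γ.walk.toCurve (meshPoint δ)⟩ : Curve ℂ) t) (D.pt 1) ∧
                Metric.infDist ((⟨γ.walk.toCurve (meshPoint δ)⟩ : Curve ℂ) t) D.carrierᶜ ≤ s} ≤
          ENNReal.ofReal ε)
    (hB : ∀ (D : DobrushinDomain) (a b : ℝ → Site 2), SAW.IsEndpointApprox D a b →
      ∀ (y : ℂ) (η R : ℝ), 0 < η → η < R → Metric.closedBall y (2 * R) ⊆ D.carrier →
        ∀ ε : ℝ, 0 < ε → ∃ (j : ℕ) (δ₁ : ℝ), 0 < δ₁ ∧ ∀ δ ∈ Set.Ioc (0 : ℝ) δ₁,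
          SAW.law D.carrier δ (a δ) (b δ)
            {γ | (⟨γ.walk.toCurve (meshPoint δ)⟩ : Curve ℂ).HasTraversals j y η R} ≤ ENNReal.ofReal ε) :
    Summit.CriticalPhenomena.SAWScalingLimit.Theorems.TPToTraversalBound.Radial.BoundaryShellTight := by
  intro D a b hab x ρ R _ hρ h4 _ ε hε
  exact perShellDecay_of_boundaryRepulsion_of_bulkShellTight hBR hB D a b hab x ρ R hρ (by linarith) ε hε

/-- **Per-shell count tightness at EVERY shell from BR and bulk tightness, in the `∃ δ₀ ∀ shells ∃ k` currency of
`shellCountTight_iff_eventualTight`** is just the crux again; recorded instead: the crux from BR and the bulk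
stub through the sibling line's fat-shell glue is the same theorem as `EventualTight_of` (two proofs of one arrow). -/
example
    (hBR : ∀ (D : DobrushinDomain) (a b : ℝ → Site 2), SAW.IsEndpointApprox D a b →
      ∀ d : ℝ, 0 < d → ∀ ε : ℝ, 0 < ε → ∃ (s δ₁ : ℝ), 0 < s ∧ 0 < δ₁ ∧ ∀ δ ∈ Set.Ioc (0 : ℝ) δ₁,
        SAW.law D.carrier δ (a δ) (b δ)
          {γ | ∃ t : I, d ≤ dist ((⟨γ.walk.toCurve (meshPoint δ)⟩ : Curve ℂ) t) (D.pt 0) ∧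
                d ≤ dist ((⟨γ.walk.toCurve (meshPoint δ)⟩ : Curve ℂ) t) (D.pt 1) ∧
                Metric.infDist ((⟨γ.walk.toCurve (meshPoint δ)⟩ : Curve ℂ) t) D.carrierᶜ ≤ s} ≤
          ENNReal.ofReal ε)
    (hB : Summit.CriticalPhenomena.SAWScalingLimit.Theses.SAWRenewalTightness.BulkShellTight) :
    Summit.CriticalPhenomena.SAWScalingLimit.Theses.SAWRenewalTightness.EventualTight :=
  eventualTight_of_bulkShellTight_of_boundaryShellTight hB
    (boundaryShellTight_of_boundaryRepulsion_of_bulkShellTight hBR hB)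

end Summit.CriticalPhenomena.SAWScalingLimit.Cruxes.EventualTight.BoundaryRepulsion

end
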